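import Summits.BirchSwinnertonDyer.BirchSwinnertonDyer.Theorems.AlignedTransportAtTwoMainConjectureOfRankZeroBSDAtTwoFineRoadInfResSharp
import Literature.NumberTheory.EllipticCurves.H1CorestrictionIndexTwo
import Mathlib.Topology.Algebra.Group.ClosedSubgroup
import HarnessLib

/-!
# Inflation–restriction, SURJECTIVE form on the seed cell: with `E(ℚ(ζ_{2^∞}))[2^∞] = 0` every
# `Δ`-invariant class of `H¹(ℚ(ζ_{2^∞}), E[2^∞])` comes from `H¹(ℚ_∞, E[2^∞])` — the restriction is an
# ISOMORPHISM onto the `Δ`-invariants (the global obstruction `H²(Δ, E(ℚ(ζ_{2^∞}))[2^∞])` of ARCH-NETTING (ii) is `0`)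

Cell `bsd-f1-sign2`, WIDTH-5 attach seat `bsd-line-att-p4` (gen 3) on line `birth` of crux C2
stmt-BirchSwinnertonDyer-22298 `MainConjectureOfRankZeroBSDAtTwo`; a `--supports 22298 --as helper` file, sequel of
`…FineRoadInfResSharp` (injectivity). HONEST FRAMING: THEOREMS ONLY — no definition, no named fact, no `sorry`; BSD is
NOT proved by any of this.

* §1 **`exists_resOfLe_eq_of_forall_conjH1_eq`** (any topological group `G`, discrete `G`-module `M`, `H₁ ≤ H₂ ≤ G`
  with `H₁` normal in `G`, OPEN in `H₂` (e.g. closed of finite index) and `M^{H₁} = 0`):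
  every class `c ∈ H¹(H₁, M)` with `conj_g c = c` for all `g ∈ H₂` is `res c̃` for a (unique, `…InfResSharp`) class
  `c̃ ∈ H¹(H₂, M)`. Construction: for `g ∈ H₂` the invariance gives a UNIQUE `a_g ∈ M` with
  `g • z(g⁻¹xg) − z(x) = x • a_g − a_g` on `H₁` (uniqueness = `M^{H₁} = 0`); `g ↦ a_g` extends `z`, is a crossed
  homomorphism, and is locally constant (`H₁` open in `H₂`, `z` continuous) — the low-degree inflation–restriction
  sequence `0 → H¹(H₂/H₁, M^{H₁}) → H¹(H₂, M) → H¹(H₁, M)^{H₂} → H²(H₂/H₁, M^{H₁})` with both ends `0`.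
* §2 (`K = ℚ`, `p = 2`, cyclotomic `κ`, no rational `2`-torsion) **`exists_resOfLe_eq_of_forall_conjH1_eq_two`**:
  every `Gal(ℚ(ζ_{2^∞})/ℚ_∞)`-invariant — indeed every `ker κ`-invariant — class of `H¹(ℚ(ζ_{2^∞}), E[2^∞])` is the
  restriction of a class of `H¹(ℚ_∞, E[2^∞])`. With `…InfResSharp.resOfLe_kerCyclotomicCharacter_injective_two`:
  `res : H¹(ℚ_∞, E[2^∞]) ≅ H¹(ℚ(ζ_{2^∞}), E[2^∞])^Δ` on the seed cell, so the cokernel of the Selmer-level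
  restrictions `Sel^{(rel)}(ℚ_∞) → Sel(ℚ(ζ_{2^∞}))^Δ` (dually `ker fd^{(rel)}`, `ker fyʳ`) is PURELY LOCAL.

References: J.-P. Serre, *Galois Cohomology* I §2.6 (b) (inflation–restriction with `H²`); R. Greenberg, LNM 1716
(1999) §3 Lemma 3.1, §4; J. Neukirch, A. Schmidt, K. Wingberg, *Cohomology of Number Fields* (1.6.7).
-/

set_option autoImplicit false
-- the Theorems namespace of this sub repeats the summit name by design (D-0017 nested layout)
set_option linter.dupNamespace false

noncomputable section

open scoped Classical Pointwise

namespace Summit.BirchSwinnertonDyer.BirchSwinnertonDyer.Theorems.AlignedTransportAtTwoFineRoad.InfResSurj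

open Literature.NumberTheory.EllipticCurves Literature.NumberTheory.GaloisRepresentations Topology

universe u

/-! ## §1 `M^{H₁} = 0`, `H₁` open in `H₂` ⟹ `H¹(H₂, M) → H¹(H₁, M)^{H₂}` is onto -/

section Generic

variable {G : Type u} [Group G] [TopologicalSpace G] [IsTopologicalGroup G]
  {M : Type u} [AddCommGroup M] [DistribMulAction G M] [TopologicalSpace M] [DiscreteTopology M]

/-- **Inflation–restriction, surjective form.** Let `H₁ ≤ H₂` be subgroups of a topological group `G` with `H₁`
normal in `G` and open in `H₂`, `M` a discrete `G`-module with `M^{H₁} = 0`. Then every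
class of `H¹(H₁, M)` fixed by `conj_g` for all `g ∈ H₂` is the restriction of a class of `H¹(H₂, M)`.
[cite: SerreGaloisCohomology1997, I §2.6 (b)] [cite: NeukirchSchmidtWingberg2008, I.§6 Prop. 1.6.7] -/
theorem exists_resOfLe_eq_of_forall_conjH1_eq {H₁ H₂ : Subgroup G} [H₁.Normal] (hle : H₁ ≤ H₂)
    (hfix : FixedPoints.addSubgroup H₁ M = ⊥)
    (hopen : IsOpen ((H₁.subgroupOf H₂ : Subgroup H₂) : Set H₂)) (c : subgroupH1 H₁ M)
    (hinv : ∀ g ∈ H₂, conjH1 H₁ M g c = c) :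
    ∃ c' : subgroupH1 H₂ M, resOfLe M hle c' = c := by
  obtain ⟨z, rfl⟩ := oneCocycleClass_surjective (discreteTopRep H₁ M) c
  -- uniqueness of boundaries (`M^{H₁} = 0`)
  have huniq : ∀ a a' : M, (∀ x : H₁, (x : G) • a - a = (x : G) • a' - a') → a = a' := by
    intro a a' h
    have hmem : a - a' ∈ FixedPoints.addSubgroup H₁ M := by
      refine (FixedPoints.mem_addSubgroup _ _ _).2 fun x ↦ ?_
      rw [Subgroup.smul_def, smul_sub]
      have hx := h x
      rw [sub_eq_sub_iff_sub_eq_sub] at hx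
      exact hx
    rw [hfix, AddSubgroup.mem_bot, sub_eq_zero] at hmem
    exact hmem
  -- existence: the invariance `conj_g [z] = [z]` on cocycles
  have hex : ∀ g : H₂, ∃ a : M,
      ∀ x : H₁, (g : G) • z.1 (subgroupConj H₁ (g : G) x) - z.1 x = (x : G) • a - a := by
    intro g
    have h := hinv g g.2
    rw [conjH1_oneCocycleClass, ← sub_eq_zero, ← oneCocycleClass_sub, oneCocycleClass_eq_zero_iff] at h
    obtain ⟨a, ha⟩ := h
    refine ⟨a, fun x ↦ ?_⟩
    have hx := ha x
    rw [sub_apply_val, conjCocycle_apply, discreteTopRep_ρ_apply, Subgroup.smul_def] at hx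
    exact hx
  choose A hA using hex
  -- (P1) `A` extends `z`
  have hA1 : ∀ (k : H₂) (hk : (k : G) ∈ H₁), A k = z.1 ⟨k, hk⟩ := by
    intro k hk
    apply huniq
    intro x
    rw [← hA k x]
    set k₁ : H₁ := ⟨k, hk⟩ with hk₁
    have e : subgroupConj H₁ (k : G) x = k₁⁻¹ * x * k₁ :=
      Subtype.ext (by rw [subgroupConj_apply_coe]; rfl)
    have hmul : k₁ * (k₁⁻¹ * x * k₁) = x * k₁ := by group
    have h1 : z.1 (x * k₁) = z.1 x + (x : G) • z.1 k₁ := cocycle_mul H₁ z x k₁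
    have h2 : z.1 (k₁ * (k₁⁻¹ * x * k₁)) = z.1 k₁ + (k₁ : G) • z.1 (k₁⁻¹ * x * k₁) :=
      cocycle_mul H₁ z k₁ _
    rw [hmul, h1] at h2
    rw [e]
    have h3 : (k : G) • z.1 (k₁⁻¹ * x * k₁) = z.1 x + (x : G) • z.1 k₁ - z.1 k₁ := by
      rw [show (k : G) = (k₁ : G) from rfl]
      exact eq_sub_of_add_eq' h2.symm
    rw [h3]
    abel
  -- (P2) `A` is a crossed homomorphism on `H₂`
  have hA2 : ∀ g g' : H₂, A (g * g') = A g + (g : G) • A g' := by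
    intro g g'
    apply huniq
    intro x
    rw [← hA (g * g') x]
    set y : H₁ := subgroupConj H₁ (g : G) x with hy
    have e1 : subgroupConj H₁ ((g * g' : H₂) : G) x = subgroupConj H₁ (g' : G) y :=
      Subtype.ext (by
        simp only [subgroupConj_apply_coe, hy, Subgroup.coe_mul, mul_inv_rev, mul_assoc])
    have h1 : (g : G) • z.1 y - z.1 x = (x : G) • A g - A g := hA g x
    have h2 : (g' : G) • z.1 (subgroupConj H₁ (g' : G) y) - z.1 y = (y : G) • A g' - A g' := hA g' y
    have hyx : (g : G) * (y : G) = (x : G) * g := by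
      rw [hy, subgroupConj_apply_coe, ← mul_assoc, ← mul_assoc, mul_inv_cancel, one_mul]
    have h2' : (g : G) • ((g' : G) • z.1 (subgroupConj H₁ (g' : G) y)) =
        (g : G) • z.1 y + ((x : G) * g) • A g' - (g : G) • A g' := by
      rw [eq_add_of_sub_eq' h2, smul_add, smul_sub, smul_smul, hyx]
      abel
    have h1' : (g : G) • z.1 y = z.1 x + (x : G) • A g - A g := by
      rw [eq_add_of_sub_eq' h1]
      abel
    rw [e1, Subgroup.coe_mul, mul_smul, h2', h1', smul_add, mul_smul]
    abel
  -- (P3) `A` is locally constant on `H₂` (`H₁` is open in `H₂`, `z` is continuous)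
  have hAcont : Continuous A := by
    refine IsLocallyConstant.continuous ((IsLocallyConstant.iff_exists_open A).2 fun g₀ ↦ ?_)
    -- the open set of `k ∈ H₁ ⊓ H₂` with `z k = 0`, read inside `H₂`
    set S : Subgroup H₂ := H₁.subgroupOf H₂ with hS
    let ι : ↥S → H₁ := fun s ↦ ⟨((s : H₂) : G), Subgroup.mem_subgroupOf.1 s.2⟩
    have hι : Continuous ι := (continuous_subtype_val.comp continuous_subtype_val).subtype_mk _
    let ζ : ↥S → M := fun s ↦ z.1 (ι s)
    have hζ : Continuous ζ := z.1.continuous.comp hι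
    set T : Set ↥S := ζ ⁻¹' {0} with hT
    have hTopen : IsOpen T := (isOpen_discrete ({0} : Set M)).preimage hζ
    set V : Set H₂ := Subtype.val '' T with hV
    have hVopen : IsOpen V := hopen.isOpenMap_subtype_val _ hTopen
    have h1V : (1 : H₂) ∈ V := by
      refine ⟨⟨1, one_mem _⟩, ?_, rfl⟩
      change z.1 ⟨((1 : H₂) : G), _⟩ = 0
      have e : (⟨((1 : H₂) : G), Subgroup.mem_subgroupOf.1 (one_mem (H₁.subgroupOf H₂))⟩ : H₁) = 1 :=
        Subtype.ext rfl
      rw [e]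
      exact cocycle_one H₁ z
    refine ⟨(g₀ * ·) '' V, isOpenMap_mul_left g₀ _ hVopen, ⟨1, h1V, mul_one g₀⟩, ?_⟩
    rintro _ ⟨k, ⟨s, hs, rfl⟩, rfl⟩
    have hk : ((s : H₂) : G) ∈ H₁ := Subgroup.mem_subgroupOf.1 s.2
    have hzs : z.1 ⟨((s : H₂) : G), hk⟩ = 0 := hs
    rw [hA2, hA1 _ hk, hzs, smul_zero, add_zero]
  -- the extended cocycle
  let zt : contOneCocycles (discreteTopRep H₂ M) :=
    ⟨⟨A, hAcont⟩, fun g h ↦ by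
      change A (g * h) = A g + (discreteTopRep H₂ M).ρ g (A h)
      rw [hA2, discreteTopRep_ρ_apply, Subgroup.smul_def]⟩
  refine ⟨oneCocycleClass _ zt, ?_⟩
  rw [resOfLe, resH1Hom_oneCocycleClass]
  congr 1
  apply Subtype.ext
  ext x
  rw [pullback_resHomOfEquivariant_apply, AddMonoidHom.id_apply]
  change A (Subgroup.inclusion hle x) = z.1 x
  rw [hA1 (Subgroup.inclusion hle x) x.2]
  exact congrArg z.1 (Subtype.ext rfl)

end Generic

/-! ## §2 The seed cell: `res : H¹(ℚ_∞, E[2^∞]) ≅ H¹(ℚ(ζ_{2^∞}), E[2^∞])^Δ` -/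

section SeedCell

open WeierstrassCurve Literature.NumberTheory.EllipticCurves.Greenberg1999

variable {K : Type} [Field K] [NumberField K] {p : ℕ} [Fact p.Prime] (κ : ZpExtension K p)

omit [NumberField K] in
/-- `ker χ_p` is OPEN in `ker κ` for the cyclotomic `ℤ_p`-extension (closed of finite index `#μ(ℤ_p)`-ish:
`InfRes.finiteIndex_ker_cyclotomicCharacter`). [cite: Washington1997, §13.1] -/
theorem isOpen_subgroupOf_kerCyclotomicCharacter (hκ : κ.IsCyclotomic) :
    IsOpen ((((GaloisRep.cyclotomicCharacter K p).toMonoidHom.ker).subgroupOf κ.kerSubgroup :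
      Subgroup κ.kerSubgroup) : Set κ.kerSubgroup) := by
  haveI := InfRes.finiteIndex_ker_cyclotomicCharacter κ hκ
  apply Subgroup.isOpen_of_isClosed_of_finiteIndex
  rw [Subgroup.coe_subgroupOf]
  refine IsClosed.preimage continuous_subtype_val ?_
  have e : (((GaloisRep.cyclotomicCharacter K p).toMonoidHom.ker : Subgroup (Field.absoluteGaloisGroup K)) :
      Set (Field.absoluteGaloisGroup K)) = (GaloisRep.cyclotomicCharacter K p) ⁻¹' {1} := by
    ext σ
    simp [MonoidHom.mem_ker]
  rw [e]
  exact isClosed_singleton.preimage (GaloisRep.cyclotomicCharacter K p).continuous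

variable (W : WeierstrassCurve ℚ) [W.IsElliptic] (κ₂ : ZpExtension ℚ 2)

/-- **Every `ker κ`-invariant class of `H¹(ℚ(ζ_{2^∞}), E[2^∞])` is a restriction from `H¹(ℚ_∞, E[2^∞])`** (elliptic `E/ℚ`
without a rational point of order `2`, cyclotomic `ℤ₂`-extension): §1 with `E(ℚ(ζ_{2^∞}))[2^∞] = 0`
(`CycTorsion.fixedPoints_kerCyclotomicCharacter_geomPrimaryTorsion_eq_bot`) and `ker χ₂` open in `ker κ`. Together with
`InfResSharp.resOfLe_kerCyclotomicCharacter_injective_two`: the restriction is an ISOMORPHISM onto the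
`Δ = Gal(ℚ(ζ_{2^∞})/ℚ_∞)`-invariants, i.e. BOTH global terms `H¹(Δ, E(K_∞)[2^∞])`, `H²(Δ, E(K_∞)[2^∞])` of the
inflation–restriction sequence vanish on the seed cell; the cokernels of the Selmer-level restrictions of
ARCH-NETTING (ii) (dually `ker fd^{(rel)}`, `ker fyʳ`) are purely LOCAL. [cite: SerreGaloisCohomology1997, I §2.6 (b)]
[cite: GreenbergLNM1716, §3 Lemma 3.1 and §4] -/
theorem exists_resOfLe_eq_of_forall_conjH1_eq_two (ht : ∀ x : ℚ, ¬ HasRationalTwoTorsionX W x)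
    (hκ : κ₂.IsCyclotomic) (c : W.subgroupH1 2 (GaloisRep.cyclotomicCharacter ℚ 2).toMonoidHom.ker)
    (hinv : ∀ g ∈ κ₂.kerSubgroup, W.conjH1 2 (GaloisRep.cyclotomicCharacter ℚ 2).toMonoidHom.ker g c = c) :
    ∃ c' : W.subgroupH1 2 κ₂.kerSubgroup,
      W.resOfLe 2 (InfRes.ker_cyclotomicCharacter_le_kerSubgroup κ₂ hκ) c' = c :=
  exists_resOfLe_eq_of_forall_conjH1_eq (M := W.geomPrimaryTorsion 2)
    (InfRes.ker_cyclotomicCharacter_le_kerSubgroup κ₂ hκ)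
    (CycTorsion.fixedPoints_kerCyclotomicCharacter_geomPrimaryTorsion_eq_bot W ht)
    (isOpen_subgroupOf_kerCyclotomicCharacter κ₂ hκ) c hinv

end SeedCell

end Summit.BirchSwinnertonDyer.BirchSwinnertonDyer.Theorems.AlignedTransportAtTwoFineRoad.InfResSurj


/-! ## §3 (APPEND, att-p4 g3) The image of restriction = the `ker κ`-invariant classes -/

namespace Summit.BirchSwinnertonDyer.BirchSwinnertonDyer.Theorems.AlignedTransportAtTwoFineRoad.InfResSurj

open WeierstrassCurve Literature.NumberTheory.EllipticCurves Literature.NumberTheory.EllipticCurves.Greenberg1999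
  Literature.NumberTheory.GaloisRepresentations

/-- **`res : H¹(ℚ_∞, E[2^∞]) ≅ H¹(ℚ(ζ_{2^∞}), E[2^∞])^Δ` on the seed cell, as one statement**: for an elliptic `E/ℚ`
without a rational point of order `2` and the cyclotomic `ℤ₂`-extension, a class over `ℚ(ζ_{2^∞})` lies in the image of
restriction IFF it is fixed by `conj_g` for every `g ∈ ker κ` (equivalently by a generator of `Δ = ker κ / ker χ₂`);
restriction is moreover injective (`InfResSharp.resOfLe_kerCyclotomicCharacter_injective_two`).
[cite: SerreGaloisCohomology1997, I §2.6 (b)] [cite: GreenbergLNM1716, §3 Lemma 3.1] -/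
theorem mem_range_resOfLe_iff_forall_conjH1_eq_two (W : WeierstrassCurve ℚ) [W.IsElliptic] (κ : ZpExtension ℚ 2)
    (ht : ∀ x : ℚ, ¬ HasRationalTwoTorsionX W x) (hκ : κ.IsCyclotomic)
    (c : W.subgroupH1 2 (GaloisRep.cyclotomicCharacter ℚ 2).toMonoidHom.ker) :
    c ∈ (W.resOfLe 2 (InfRes.ker_cyclotomicCharacter_le_kerSubgroup κ hκ)).range ↔
      ∀ g ∈ κ.kerSubgroup, W.conjH1 2 (GaloisRep.cyclotomicCharacter ℚ 2).toMonoidHom.ker g c = c := by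
  constructor
  · rintro ⟨c', rfl⟩ g hg
    exact conjH1_resOfLe_of_mem (M := W.geomPrimaryTorsion 2)
      (InfRes.ker_cyclotomicCharacter_le_kerSubgroup κ hκ) hg c'
  · intro hinv
    obtain ⟨c', hc'⟩ := exists_resOfLe_eq_of_forall_conjH1_eq_two W κ ht hκ c hinv
    exact ⟨c', hc'⟩

end Summit.BirchSwinnertonDyer.BirchSwinnertonDyer.Theorems.AlignedTransportAtTwoFineRoad.InfResSurj
end
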